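import Summits.QuantumFields.YangMills.Theorems.FluctuationComparisonRegPrIntLS2BetaChartReadDescentDerivKStepSupT3
import Summits.QuantumFields.YangMills.Theorems.FluctuationComparisonRegPrIntLS2BetaChartReadGaugeAndLocality
import HarnessLib

/-!
# S2β · (D2-loc) THE k-STEP SUP BOUND IS LOCAL: `‖↑((DΨ_k(0) X) B)‖ ≤ (1 + 4(d+2))·e^{c₃Σα}·L^k·‖X^{(B,k)}‖_∞` — (D2) ✓p825421 AT THE TRUNCATION OF `X` TO THE BONDS `B` READS THROUGH
# `k` STEPS ((B1) ✓p825137 sharp locality), generic AND at the T³ organ (`DM_{J←K}(U₀) ζ B`, (G) ✓p825913 ∕ (E) ✓p824808 currency) — the propagation letter of the SUP chain for `hLoc`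

Cell `ym3-torus` (YM ladder rung R3 = continuum `SU(2)` Yang–Mills on the three-torus at fixed lattice data — a RUNG: NOT d = 4, NOT infinite volume, NOT a mass gap,
NOT Clay).  Width seat `ym3-torus-px13` (gen 26); crux `stmt-QuantumFields-20520`, LINE g18-1 S2β, pairing lane; `hLoc` (px16 g22 ✓p828403's local text of record) assembly.
px17 g22's ASSEMBLY CHECK (16:34:36Z): the `ℓ¹` chain cannot close `hLoc` K-uniformly (the one-step brick is blind to the (G-smooth) commutator, so at the finest level
`Σ_c C·sup² ≍ C·d²` with no `N⁻¹`); the SUP chain (Q7 ✓p827759 + (β-3) ✓p828183 sup-local brick + (D2) k-uniform `A·e^{c₃Σα}·L^k` + ITS LOCAL EDITION + a sup tower budget (ST))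
passes the three test families.  THIS FILE is that local edition — `--kind proof --supports stmt-QuantumFields-20520 --as helper`, count-neutral, DEFINITION-FREE.

OBJECTS (written out).  Generic `P : Params`, `SU(N)`: `Ψ_k(A)(c) = Λ(Ū^k(Θ^B(A)·U₀)(c)·Ū^k(U₀)(c)⁻¹)` (✓p823800); the READ SET of a level-`k` bond `B` through `k` steps = the level-`0` bonds `b`
with `blockIter k b.src ∈ {B.src, B.tgt}` AND `blockIter k b.tgt ∈ {B.src, B.tgt}` ((B1)'s sharp reading, lit `B14.Eq22Determines.blockIter`); the TRUNCATION `X^{(B,k)} b := if (read) then X b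
else 0`.  T³ organ (`F : T3Family`, `SU(2)`): `DM_{J←K}(U₀) = fderiv ℝ (ζ ↦ (B ↦ Λ(D_{J,K}(expPoint ζ•U₀) B·D_{J,K}U₀ B⁻¹))) 0` with `D_{J,K} = descendTo F ℰp J K` (= `fieldShift ∘ Ū^{K−J}`, (E)),
read set of `B : PBond (F.P J) 0` = the one of `bondShift … B : PBond (F.P K) (K − J)` at depth `K − J`.

WHAT IS PROVED (sorry-free).
* §1 `fderiv_chartRead_iter_apply_eq_truncate` — `(DΨ_k(0) X) B = (DΨ_k(0) X^{(B,k)}) B` (`k ≤ m + K`; linearity of `fderiv` + (B1) ✓`fderiv_chartRead_iter_apply_eq_zero_of_forall` on `X − X^{(B,k)}`);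
  `norm_truncate_le` (`‖X^{(B,k)}‖ ≤ m` whenever `‖X b‖ ≤ m` on the read set, `0 ≤ m`).
* §2 ★★★`norm_fderiv_chartRead_iter_apply_le_local` — (D2) at the truncation: **`‖↑((DΨ_k(0) X) B)‖ ≤ (1 + 4(d+2))·Π_{i<k}(1 + c₃α_i)·L^k·‖X^{(B,k)}‖`**; ★★★`…_le_local_exp` (the `exp(c₃Σα)` form);
  ★★★`…_le_of_forall_read` — **`(∀ b ∈ read(B,k), ‖X b‖ ≤ m) → ‖↑((DΨ_k(0) X) B)‖ ≤ (1 + 4(d+2))·e^{c₃Σ_{i<k}α_i}·L^k·m`** (`max_{read}` currency).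
* §3 ★★★`norm_fderiv_chartRead_descendTo_expPoint_apply_le_of_forall_read` — THE T³ ORGAN EDITION: for `U₀ ∈ histGood F ℰp θ K J` with the dictionary guard (`θ ≥ 0`,
  `(5L)²∕4·θ_h ≤ 1∕24`, `< δ_{SU(2)}` on `J < h ≤ K`) and EVERY `ζ` with `‖ζ ℓ‖ ≤ m` on the read set of `B`: **`‖↑((DM_{J←K}(U₀) ζ) B)‖ ≤ (1 + 4(d+2))·e^{c₃Σ_{i<K−J}(5L)²∕4·θ(K−i)}·L^{K−J}·m`**
  ((E) ✓`fderiv_chartRead_descendTo_expPoint_apply` + §2 at `bondShift B` + the Pauli isometry ✓`norm_coord_eq`).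
  The `DMq` (quaternion-read) edition of the organ form is px5 g23's ✓p828851 `…QuaternionReadDerivLocalSup.norm_qfderiv_apply_le_local` (Q10) — NOT restated here.

HONEST.  Linearity + locality bookkeeping over (D2), (B1), (E), (G); nothing of Bałaban's beyond what those carry ((139)–(147) is (D2)); (ST)∕(SCT) (px17 g22's hypothesis texts), `hLoc`,
AVG₂♭-ax_q, «MULT♭-ax»∕«CRIT-ax», (D-ax), GAP♯∘ (registry UNTOUCHED), the five REGISTERED stubs, S2β, crux 20520, 19936, 19200, `YM3TorusSU2` — NOT proved; rung R3 = SU(2) YM₃ on T³ at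
fixed lattice data — NOT d = 4, NOT infinite volume, NOT a mass gap, NOT Clay; the Yang–Mills mass gap is NOT proved.  Axioms standard.

References: [Balaban1985Averaging] CMP **98** (1985) Prop. 4 (127)–(135) pp.37–38, (139)–(147) pp.39–40, p.19 (locality); [Balaban1987RG1] CMP **109** (1987) (0.11) p.253.
-/

set_option autoImplicit false

noncomputable section

open scoped BigOperators Matrix.Norms.L2Operator Topology
open Filter Set Function

namespace Summit.QuantumFields.YangMills.Theorems.FluctuationComparisonRegPrIntLS2BetaChartReadDerivKStepSupLocal

open Literature.MathematicalPhysics.QuantumFieldTheory.Balaban1983to89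
open Literature.MathematicalPhysics.QuantumFieldTheory.Balaban1983to89.HaarExponentialChart
open Literature.MathematicalPhysics.QuantumFieldTheory.Balaban1983to89.HaarExponentialChart.IsChartRep
open Literature.MathematicalPhysics.QuantumFieldTheory.Balaban1983to89.BlockAveraging (Small Idx avgFun loopHol blockAvg)
open Literature.MathematicalPhysics.QuantumFieldTheory.Balaban1983to89.ExpMeanLog (expMeanLogSU deltaSU)
open Literature.MathematicalPhysics.QuantumFieldTheory.Balaban1983to89.Node00
open Literature.MathematicalPhysics.QuantumFieldTheory.Balaban1983to89.T3ContinuumYM3Torus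
open Literature.MathematicalPhysics.QuantumFieldTheory.Balaban1983to89.T3UnitLawDensityEML (ℰp)
open Literature.MathematicalPhysics.QuantumFieldTheory.Balaban1983to89.T3UnitScaleTilt
open Literature.MathematicalPhysics.QuantumFieldTheory.Balaban1983to89.T3TiltDescent
open Literature.MathematicalPhysics.QuantumFieldTheory.Balaban1983to89.T3LevelShift (fieldShift bondShift)
open Literature.MathematicalPhysics.QuantumFieldTheory.Balaban1983to89.T4HaarSU2ExpChart (expPoint)
open Literature.MathematicalPhysics.QuantumFieldTheory.Balaban1983to89.B10Eq18SigmaSU2 (su2Coord)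
open Literature.MathematicalPhysics.QuantumFieldTheory.Balaban1983to89.B10Eq18SigmaSU2Haar (rev)
open Summit.QuantumFields.YangMills.Theorems.FluctuationComparisonRegPrIntLS2BetaChartReadDescentOntoExpPoint (su2Coord_rev_mem_lie)
open Summit.QuantumFields.YangMills.Theorems.FluctuationComparisonRegPrIntLS2BetaChartReadDescentDerivFactorisation (fderiv_chartRead_descendTo_expPoint_apply)
open Summit.QuantumFields.YangMills.Theorems.FluctuationComparisonRegPrIntLS2BetaChartReadDerivKStepSup (norm_fderiv_chartRead_iter_apply_le norm_fderiv_chartRead_iter_apply_le_exp)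
open Summit.QuantumFields.YangMills.Theorems.FluctuationComparisonRegPrIntLS2BetaChartReadDescentDerivKStepSupT3 (norm_coord_eq loopGuardAt_of_histGood)
open Summit.QuantumFields.YangMills.Theorems.FluctuationComparisonRegPrIntLS2BetaChartReadGaugeAndLocality (fderiv_chartRead_iter_apply_eq_zero_of_forall)

/-! ## §1 The truncation to the read set, and the derivative only sees it -/

section Truncate

variable {P : Params} {N : ℕ} [NeZero N] (U₀ : GaugeField P 0 (SU N))

/-- **THE k-STEP DERIVATIVE AT `B` ONLY SEES THE READ SET OF `B`**: `(DΨ_k(0) X) B = (DΨ_k(0) X^{(B,k)}) B` (linearity of the Fréchet derivative and (B1)'s sharp vanishing on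
`X − X^{(B,k)}`, which is `0` on the read set). [cite: Balaban1985Averaging, p.19, Prop. 4 p.37] -/
theorem fderiv_chartRead_iter_apply_eq_truncate {k : ℕ} (hk : k ≤ P.m + P.K) (B : PBond P k) (X : PBond P 0 → (specialUnitaryLogChart (Fin N)).lie) :
    fderiv ℝ (fun (A : PBond P 0 → (specialUnitaryLogChart (Fin N)).lie) (c : PBond P k) => (isChartRep_specialUnitaryGroup (n := Fin N)).logChart (Averaging.iter (fun i => blockAvg (P := P) (j := i) (expMeanLogSU (n := Fin N))) k (fun b => (isChartRep_specialUnitaryGroup (n := Fin N)).expChart (A b) * U₀ b) c * (Averaging.iter (fun i => blockAvg (P := P) (j := i) (expMeanLogSU (n := Fin N))) k U₀ c)⁻¹)) 0 X B = fderiv ℝ (fun (A : PBond P 0 → (specialUnitaryLogChart (Fin N)).lie) (c : PBond P k) => (isChartRep_specialUnitaryGroup (n := Fin N)).logChart (Averaging.iter (fun i => blockAvg (P := P) (j := i) (expMeanLogSU (n := Fin N))) k (fun b => (isChartRep_specialUnitaryGroup (n := Fin N)).expChart (A b) * U₀ b) c * (Averaging.iter (fun i => blockAvg (P := P) (j :=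 i) (expMeanLogSU (n := Fin N))) k U₀ c)⁻¹)) 0 (fun b : PBond P 0 => if (B14.Eq22Determines.blockIter k b.src = B.src ∨ B14.Eq22Determines.blockIter k b.src = B.tgt) ∧ (B14.Eq22Determines.blockIter k b.tgt = B.src ∨ B14.Eq22Determines.blockIter k b.tgt = B.tgt) then X b else 0) B := by
  classical
  have hzero := fderiv_chartRead_iter_apply_eq_zero_of_forall (P := P) (N := N) U₀ hk B (X - (fun b : PBond P 0 => if (B14.Eq22Determines.blockIter k b.src = B.src ∨ B14.Eq22Determines.blockIter k b.src = B.tgt) ∧ (B14.Eq22Determines.blockIter k b.tgt = B.src ∨ B14.Eq22Determines.blockIter k b.tgt = B.tgt) then X b else 0)) fun b hs ht => by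
    simp only [Pi.sub_apply, hs, ht, and_self, if_true, sub_self]
  rw [map_sub, Pi.sub_apply, sub_eq_zero] at hzero
  exact hzero

/-- The truncation's sup norm is at most any common bound of `‖X b‖` on the read set. [folklore] -/
theorem norm_truncate_le {k : ℕ} (B : PBond P k) (X : PBond P 0 → (specialUnitaryLogChart (Fin N)).lie) {m : ℝ} (hm : 0 ≤ m)
    (hX : ∀ b : PBond P 0, (B14.Eq22Determines.blockIter k b.src = B.src ∨ B14.Eq22Determines.blockIter k b.src = B.tgt) ∧ (B14.Eq22Determines.blockIter k b.tgt = B.src ∨ B14.Eq22Determines.blockIter k b.tgt = B.tgt) → ‖X b‖ ≤ m) :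
    ‖(fun b : PBond P 0 => if (B14.Eq22Determines.blockIter k b.src = B.src ∨ B14.Eq22Determines.blockIter k b.src = B.tgt) ∧ (B14.Eq22Determines.blockIter k b.tgt = B.src ∨ B14.Eq22Determines.blockIter k b.tgt = B.tgt) then X b else 0)‖ ≤ m := by
  classical
  refine (pi_norm_le_iff_of_nonneg hm).2 fun b => ?_
  by_cases h : (B14.Eq22Determines.blockIter k b.src = B.src ∨ B14.Eq22Determines.blockIter k b.src = B.tgt) ∧ (B14.Eq22Determines.blockIter k b.tgt = B.src ∨ B14.Eq22Determines.blockIter k b.tgt = B.tgt)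
  · simp only [h, and_self, if_true]; exact hX b h
  · simp only [h, if_false, norm_zero]; exact hm

end Truncate

/-! ## §2 (D2) at the truncation -/

section Local

variable {P : Params} {N : ℕ} [NeZero N] (U₀ : GaugeField P 0 (SU N))

/-- ★★★ **(D2-loc)**: under (D2)'s guards and `k ≤ m + K`:  `‖↑((DΨ_k(0) X) B)‖ ≤ (1 + 4(d+2))·Π_{i<k}(1 + c₃α_i)·L^k·‖X^{(B,k)}‖_∞`. [cite: Balaban1985Averaging, (139)-(147) pp.39-40, p.19] -/
theorem norm_fderiv_chartRead_iter_apply_le_local (X : PBond P 0 → (specialUnitaryLogChart (Fin N)).lie) {α : ℕ → ℝ}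
    (hα0 : ∀ i, 0 ≤ α i) (hα24 : ∀ i, α i ≤ 1 / 24) (hαδ : ∀ i, α i < deltaSU (Fin N)) (k : ℕ) (hk : k ≤ P.m + P.K)
    (hα : ∀ i, i < k → ∀ (c : PBond P (i + 1)) (idx : Idx P),
      dist1 (loopHol (Averaging.iter (fun i => blockAvg (P := P) (j := i) (expMeanLogSU (n := Fin N))) i U₀) c idx) ≤ α i)
    (B : PBond P k) :
    ‖((fderiv ℝ (fun (A : PBond P 0 → (specialUnitaryLogChart (Fin N)).lie) (c : PBond P k) => (isChartRep_specialUnitaryGroup (n := Fin N)).logChart (Averaging.iter (fun i => blockAvg (P := P) (j := i) (expMeanLogSU (n := Fin N))) k (fun b => (isChartRep_specialUnitaryGroup (n := Fin N)).expChart (A b) * U₀ b) c * (Averaging.iter (fun i => blockAvg (P := P) (j := i) (expMeanLogSU (n := Fin N))) k U₀ c)⁻¹)) 0 X B : (specialUnitaryLogChart (Fin N)).lie) : Matrix (Fin N) (Fin N) ℂ)‖ ≤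
      (1 + 4 * ((P.d + 2 : ℕ) : ℝ)) * (∏ j ∈ Finset.range k, (1 + ((P.d + 2 : ℕ) : ℝ) * (422 + 1616 * ((P.d + 2 : ℕ) : ℝ)) * α j)) * (P.L : ℝ) ^ k * ‖(fun b : PBond P 0 => if (B14.Eq22Determines.blockIter k b.src = B.src ∨ B14.Eq22Determines.blockIter k b.src = B.tgt) ∧ (B14.Eq22Determines.blockIter k b.tgt = B.src ∨ B14.Eq22Determines.blockIter k b.tgt = B.tgt) then X b else 0)‖ := by
  rw [fderiv_chartRead_iter_apply_eq_truncate (P := P) (N := N) U₀ hk B X]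
  exact norm_fderiv_chartRead_iter_apply_le (P := P) (N := N) U₀ _ hα0 hα24 hαδ k hα B

/-- ★★★ **(D2-loc), EXPONENTIAL FORM**: `‖↑((DΨ_k(0) X) B)‖ ≤ (1 + 4(d+2))·e^{c₃Σ_{i<k}α_i}·L^k·‖X^{(B,k)}‖_∞`. [cite: Balaban1985Averaging, (147) p.40, p.19] -/
theorem norm_fderiv_chartRead_iter_apply_le_local_exp (X : PBond P 0 → (specialUnitaryLogChart (Fin N)).lie) {α : ℕ → ℝ}
    (hα0 : ∀ i, 0 ≤ α i) (hα24 : ∀ i, α i ≤ 1 / 24) (hαδ : ∀ i, α i < deltaSU (Fin N)) (k : ℕ) (hk : k ≤ P.m + P.K)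
    (hα : ∀ i, i < k → ∀ (c : PBond P (i + 1)) (idx : Idx P),
      dist1 (loopHol (Averaging.iter (fun i => blockAvg (P := P) (j := i) (expMeanLogSU (n := Fin N))) i U₀) c idx) ≤ α i)
    (B : PBond P k) :
    ‖((fderiv ℝ (fun (A : PBond P 0 → (specialUnitaryLogChart (Fin N)).lie) (c : PBond P k) => (isChartRep_specialUnitaryGroup (n := Fin N)).logChart (Averaging.iter (fun i => blockAvg (P := P) (j := i) (expMeanLogSU (n := Fin N))) k (fun b => (isChartRep_specialUnitaryGroup (n := Fin N)).expChart (A b) * U₀ b) c * (Averaging.iter (fun i => blockAvg (P := P) (j := i) (expMeanLogSU (n := Fin N))) k U₀ c)⁻¹)) 0 X B : (specialUnitaryLogChart (Fin N)).lie) : Matrix (Fin N) (Fin N) ℂ)‖ ≤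
      (1 + 4 * ((P.d + 2 : ℕ) : ℝ)) * Real.exp (((P.d + 2 : ℕ) : ℝ) * (422 + 1616 * ((P.d + 2 : ℕ) : ℝ)) * ∑ j ∈ Finset.range k, α j) * (P.L : ℝ) ^ k * ‖(fun b : PBond P 0 => if (B14.Eq22Determines.blockIter k b.src = B.src ∨ B14.Eq22Determines.blockIter k b.src = B.tgt) ∧ (B14.Eq22Determines.blockIter k b.tgt = B.src ∨ B14.Eq22Determines.blockIter k b.tgt = B.tgt) then X b else 0)‖ := by
  rw [fderiv_chartRead_iter_apply_eq_truncate (P := P) (N := N) U₀ hk B X]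
  exact norm_fderiv_chartRead_iter_apply_le_exp (P := P) (N := N) U₀ _ hα0 hα24 hαδ k hα B

/-- ★★★ **(D2-loc) IN `max_{read}` CURRENCY**: if `‖X b‖ ≤ m` on the read set of `B` (`0 ≤ m`) then `‖↑((DΨ_k(0) X) B)‖ ≤ (1 + 4(d+2))·e^{c₃Σ_{i<k}α_i}·L^k·m` — the propagation
letter of the SUP chain (`‖(T_t Y)(B)‖ ≤ A·L^t·max_{read_t(B)}‖Y‖`). [cite: Balaban1985Averaging, (147) p.40, p.19] -/
theorem norm_fderiv_chartRead_iter_apply_le_of_forall_read (X : PBond P 0 → (specialUnitaryLogChart (Fin N)).lie) {α : ℕ → ℝ}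
    (hα0 : ∀ i, 0 ≤ α i) (hα24 : ∀ i, α i ≤ 1 / 24) (hαδ : ∀ i, α i < deltaSU (Fin N)) (k : ℕ) (hk : k ≤ P.m + P.K)
    (hα : ∀ i, i < k → ∀ (c : PBond P (i + 1)) (idx : Idx P),
      dist1 (loopHol (Averaging.iter (fun i => blockAvg (P := P) (j := i) (expMeanLogSU (n := Fin N))) i U₀) c idx) ≤ α i)
    (B : PBond P k) {m : ℝ} (hm : 0 ≤ m) (hX : ∀ b : PBond P 0, (B14.Eq22Determines.blockIter k b.src = B.src ∨ B14.Eq22Determines.blockIter k b.src = B.tgt) ∧ (B14.Eq22Determines.blockIter k b.tgt = B.src ∨ B14.Eq22Determines.blockIter k b.tgt = B.tgt) → ‖X b‖ ≤ m) :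
    ‖((fderiv ℝ (fun (A : PBond P 0 → (specialUnitaryLogChart (Fin N)).lie) (c : PBond P k) => (isChartRep_specialUnitaryGroup (n := Fin N)).logChart (Averaging.iter (fun i => blockAvg (P := P) (j := i) (expMeanLogSU (n := Fin N))) k (fun b => (isChartRep_specialUnitaryGroup (n := Fin N)).expChart (A b) * U₀ b) c * (Averaging.iter (fun i => blockAvg (P := P) (j := i) (expMeanLogSU (n := Fin N))) k U₀ c)⁻¹)) 0 X B : (specialUnitaryLogChart (Fin N)).lie) : Matrix (Fin N) (Fin N) ℂ)‖ ≤
      (1 + 4 * ((P.d + 2 : ℕ) : ℝ)) * Real.exp (((P.d + 2 : ℕ) : ℝ) * (422 + 1616 * ((P.d + 2 : ℕ) : ℝ)) * ∑ j ∈ Finset.range k, α j) * (P.L : ℝ) ^ k * m := by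
  have h := norm_fderiv_chartRead_iter_apply_le_local_exp (P := P) (N := N) U₀ X hα0 hα24 hαδ k hk hα B
  have ht := norm_truncate_le (P := P) (N := N) B X hm hX
  have hC : 0 ≤ (1 + 4 * ((P.d + 2 : ℕ) : ℝ)) * Real.exp (((P.d + 2 : ℕ) : ℝ) * (422 + 1616 * ((P.d + 2 : ℕ) : ℝ)) * ∑ j ∈ Finset.range k, α j) * (P.L : ℝ) ^ k := by positivity
  exact h.trans (mul_le_mul_of_nonneg_left ht hC)

end Local

/-! ## §3 The T³ organ edition: `‖↑((DM_{J←K}(U₀) ζ) B)‖ ≤ A·L^{K−J}·max_{read(B)}‖ζ‖` -/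

section Organ

variable {F : T3Family}

/-- ★★★ **(D2-loc) AT THE T³ ORGAN**: for a good history `U₀ ∈ histGood F ℰp θ K J` with the dictionary guard and EVERY `ζ` with `‖ζ ℓ‖ ≤ m` (`0 ≤ m`) on the read set of `B` (the level-`0`
bonds `ℓ` of `F.P K` with `blockIter (K−J) ℓ.src, ℓ.tgt ∈ {(bondShift B).src, (bondShift B).tgt}`):  **`‖↑((DM_{J←K}(U₀) ζ) B)‖ ≤ (1 + 4(d+2))·e^{c₃·Σ_{i<K−J}(5L)²∕4·θ(K−i)}·L^{K−J}·m`**.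
[cite: Balaban1985Averaging, (147) p.40, p.19; Balaban1985UV3, p.260] -/
theorem norm_fderiv_chartRead_descendTo_expPoint_apply_le_of_forall_read {J K : ℕ} (hJK : J ≤ K) {θ : ℕ → ℝ} (hθ0 : ∀ i, 0 ≤ θ i)
    (hθ24 : ∀ h, J < h → h ≤ K → (((5 * F.L : ℕ) : ℝ) ^ 2 / 4) * θ h ≤ 1 / 24)
    (hθδ : ∀ h, J < h → h ≤ K → (((5 * F.L : ℕ) : ℝ) ^ 2 / 4) * θ h < deltaSU (Fin 2))
    {U₀ : GaugeField (F.P K) 0 (SU 2)} (hUg : U₀ ∈ histGood F ℰp θ K J)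
    (ζ : PBond (F.P K) 0 → EuclideanSpace ℝ (Fin 3)) (B : PBond (F.P J) 0) {m : ℝ} (hm : 0 ≤ m)
    (hζ : ∀ ℓ : PBond (F.P K) 0, (B14.Eq22Determines.blockIter (K - J) ℓ.src = (bondShift (F.sitesPerDir_eq (m := F.m) (K := J) (j := 0) (m' := F.m) (K' := K) (j' := K - J) (by omega)) B).src ∨ B14.Eq22Determines.blockIter (K - J) ℓ.src = (bondShift (F.sitesPerDir_eq (m := F.m) (K := J) (j := 0) (m' := F.m) (K' := K) (j' := K - J) (by omega)) B).tgt) ∧ (B14.Eq22Determines.blockIter (K - J) ℓ.tgt = (bondShift (F.sitesPerDir_eq (m := F.m) (K := J) (j := 0) (m' := F.m) (K' := K) (j' := K - J) (by omega)) B).src ∨ B14.Eq22Determines.blockIter (K - J) ℓ.tgt = (bondShift (F.sitesPerDir_eq (m := F.m) (K := J) (j := 0) (m' := F.m) (K' := K) (j' := K - J) (by omega)) B).tgt) → ‖ζ ℓ‖ ≤ m) :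
    ‖((fderiv ℝ (fun (ζ : PBond (F.P K) 0 → EuclideanSpace ℝ (Fin 3)) (B : PBond (F.P J) 0) => (isChartRep_specialUnitaryGroup (n := Fin 2)).logChart (descendTo F ℰp J K hJK (fun ℓ => expPoint (ζ ℓ) * U₀ ℓ) B * (descendTo F ℰp J K hJK U₀ B)⁻¹)) 0 ζ B : (specialUnitaryLogChart (Fin 2)).lie) : Matrix (Fin 2) (Fin 2) ℂ)‖ ≤
      (1 + 4 * (((F.P K).d + 2 : ℕ) : ℝ)) *
          Real.exp ((((F.P K).d + 2 : ℕ) : ℝ) * (422 + 1616 * (((F.P K).d + 2 : ℕ) : ℝ)) * ∑ i ∈ Finset.range (K - J), (((5 * F.L : ℕ) : ℝ) ^ 2 / 4) * θ (K - i)) *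
        ((F.P K).L : ℝ) ^ (K - J) * m := by
  -- the per-level guard profile, as in (G)
  set α : ℕ → ℝ := fun i => if i < K - J then (((5 * F.L : ℕ) : ℝ) ^ 2 / 4) * θ (K - i) else 0 with hαdef
  have hα0 : ∀ i, 0 ≤ α i := by
    intro i; simp only [hαdef]; split_ifs
    · exact mul_nonneg (by positivity) (hθ0 _)
    · exact le_rfl
  have hα24 : ∀ i, α i ≤ 1 / 24 := by
    intro i; simp only [hαdef]; split_ifs with hi
    · exact hθ24 (K - i) (by omega) (by omega)
    · norm_num
  have hαδ : ∀ i, α i < deltaSU (Fin 2) := by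
    intro i; simp only [hαdef]; split_ifs with hi
    · exact hθδ (K - i) (by omega) (by omega)
    · exact ExpMeanLog.deltaSU_pos
  have hα : ∀ i, i < K - J → ∀ (c : PBond (F.P K) (i + 1)) (idx : Idx (F.P K)),
      dist1 (loopHol (Averaging.iter (fun i => blockAvg (P := F.P K) (j := i) (expMeanLogSU (n := Fin 2))) i U₀) c idx) ≤ α i := by
    intro i hi c idx
    have h := loopGuardAt_of_histGood (F := F) hθ0 hUg i hi c idx
    simp only [hαdef, if_pos hi]
    exact h
  have hk : K - J ≤ (F.P K).m + (F.P K).K := by show K - J ≤ F.m + K; omega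
  rw [fderiv_chartRead_descendTo_expPoint_apply (F := F) hJK hθ0 hθδ hUg ζ B]
  have hX : ∀ b : PBond (F.P K) 0, (B14.Eq22Determines.blockIter (K - J) b.src = (bondShift (F.sitesPerDir_eq (m := F.m) (K := J) (j := 0) (m' := F.m) (K' := K) (j' := K - J) (by omega)) B).src ∨ B14.Eq22Determines.blockIter (K - J) b.src = (bondShift (F.sitesPerDir_eq (m := F.m) (K := J) (j := 0) (m' := F.m) (K' := K) (j' := K - J) (by omega)) B).tgt) ∧ (B14.Eq22Determines.blockIter (K - J) b.tgt = (bondShift (F.sitesPerDir_eq (m := F.m) (K := J) (j := 0) (m' := F.m) (K' := K) (j' := K - J) (by omega)) B).src ∨ B14.Eq22Determines.blockIter (K - J) b.tgt = (bondShift (F.sitesPerDir_eq (m := F.m) (K := J) (j := 0) (m' := F.m) (K' := K) (j' := K - J) (by omega)) B).tgt) →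
      ‖(⟨su2Coord (rev (ζ b)), su2Coord_rev_mem_lie (ζ b)⟩ : (specialUnitaryLogChart (Fin 2)).lie)‖ ≤ m := fun b hb => by
    rw [norm_coord_eq]; exact hζ b hb
  have hmain := norm_fderiv_chartRead_iter_apply_le_of_forall_read (P := F.P K) (N := 2) U₀
    (fun b => (⟨su2Coord (rev (ζ b)), su2Coord_rev_mem_lie (ζ b)⟩ : (specialUnitaryLogChart (Fin 2)).lie)) hα0 hα24 hαδ (K - J) hk hα (bondShift (F.sitesPerDir_eq (m := F.m) (K := J) (j := 0) (m' := F.m) (K' := K) (j' := K - J) (by omega)) B) hm hX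
  refine hmain.trans (le_of_eq ?_)
  have hsum : ∑ j ∈ Finset.range (K - J), α j = ∑ i ∈ Finset.range (K - J), (((5 * F.L : ℕ) : ℝ) ^ 2 / 4) * θ (K - i) :=
    Finset.sum_congr rfl fun i hi => by simp only [hαdef, if_pos (Finset.mem_range.1 hi)]
  rw [hsum]

end Organ


end Summit.QuantumFields.YangMills.Theorems.FluctuationComparisonRegPrIntLS2BetaChartReadDerivKStepSupLocal

end
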